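/-
Copyright: seat `ym-line-cbag-p2` (prover-ym-line-cbag-p2-g0-0), route `ColdBoxAllGroups`, crux `BulkAllGroups`
(stmt-QuantumFields-22255), line `dlr-chessboard-G` (skeleton `Cruxes/BulkAllGroups/Lines/birth.lean`).
-/
import Summits.QuantumFields.YangMills.Theorems.WeakCouplingRatesColdBoxDirichletShiftedMean
import Summits.QuantumFields.YangMills.Theorems.ColdBoxAllGroupsBoxFloorAllGroupsGaussSideD

/-!
# Crux `BulkAllGroups` (stmt-QuantumFields-22255), interface `KernelMeanExpansionG`: the Gaussian side of the kernel MEAN expansion with a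
# datum for `D` colours — `D`-colour port of §3–§4 of `WeakCouplingRatesColdBoxDirichletShiftedMean` (group-free)

The one-scale expansion of the box kernel with a small Dirichlet datum, for a compact group with `D = dimE ρ` chart coordinates per link,
linearises to `D` independent temporal-gauge Dirichlet Gaussians `D^{⊗D}` (the sibling line's `gaussD H D`), the plaquette cost reading
`½ Σ_{c<D} (F_c + X_q(t_c))²` with the background circulations `F_c` of the datum.  This file supplies the `D`-colour Gaussian bookkeeping
the A-mean core consumes (the `SU(2)` file has the case `D = 3` with the constant `3/2`):

* `integrable_comp_eval_piD` — integrability transfers from one colour to the product;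
* `integral_quadObs_piD_eq` — `E_{D^{⊗D}}[½Σ_c (F_c + X_q(t_c))²] = (D/2)·V_D(q) + ½Σ_c F_c²` (`V_D = boxDirProjKernel H q q`);
* `integral_quadObs_sq_piD_le` — `E_{D^{⊗D}}[(½Σ_c (F_c + X_q(t_c))²)²] ≤ 2D·Σ_c (F_c⁴ + 3V_D(q)²)` (pointwise Cauchy–Schwarz
  `(Σ_c Y_c)² ≤ D Σ_c Y_c²`, the sibling line's `sq_sum_le_card_mul_sum_sq`, and the one-colour shifted fourth moment);
* `memLp_two_quadObs_piD`, `abs_integral_cond_quadObs_sub_leD` (restriction to a likely event, `√η` form), and the datum forms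
  `abs_integral_cond_quadObs_datum_sub_leD` / `integral_quadObs_datum_eqD` (circulation affine in the free variables, `sCirc_glue_add_ofLp`).
Pure Gaussian bookkeeping over the tree's D1' objects; no group, no chart.  No new definition; standard axioms.  NOT a claim about the mass gap;
the Yang–Mills mass gap is NOT proved by any of this.
-/

set_option autoImplicit false

noncomputable section

open MeasureTheory ProbabilityTheory Finset Matrix Real
open Literature.Probability.LatticeModels
open Literature.MathematicalPhysics.QuantumLattice
open Literature.MathematicalPhysics.QuantumFieldTheory
open Literature.MathematicalPhysics.QuantumFieldTheory.LatticeMaxwell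
open Literature.MathematicalPhysics.QuantumFieldTheory.AxialGauge
open Summit.QuantumFields.YangMills.Theorems.WeakCouplingRates

namespace Summit.QuantumFields.YangMills.Theorems.ColdBoxAllGroups

variable {H D : ℕ}

/-- Integrability transfers from one colour to the product: `t ↦ g(t_c)` is integrable under `D^{⊗D}` if `g` is under `D1'`. [folklore] -/
theorem integrable_comp_eval_piD {g : EuclideanSpace ℝ (DirFree H) → ℝ} (hg : Integrable g (boxDirichlet H)) (c : Fin D) :
    Integrable (fun t : Fin D → EuclideanSpace ℝ (DirFree H) => g (t c)) (Measure.pi fun _ : Fin D => boxDirichlet H) := by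
  have hmp := MeasureTheory.measurePreserving_eval (μ := fun _ : Fin D => boxDirichlet H) c
  exact (hmp.integrable_comp hg.aestronglyMeasurable).2 hg

/-- **`D` colours, exact mean**: `E_{D^{⊗D}}[½Σ_c (F_c + X_q(t_c))²] = (D/2)·V_D(q) + ½Σ_c F_c²`. [folklore] -/
theorem integral_quadObs_piD_eq (F : Fin D → ℝ) (q : Plaq 4) :
    ∫ t : Fin D → EuclideanSpace ℝ (DirFree H), (1 / 2 : ℝ) * ∑ c, (F c + dirCirc H q (t c)) ^ 2
        ∂(Measure.pi fun _ : Fin D => boxDirichlet H) =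
      (D : ℝ) / 2 * boxDirProjKernel H q q + 1 / 2 * ∑ c, F c ^ 2 := by
  have hint : ∀ c : Fin D, Integrable (fun t : Fin D → EuclideanSpace ℝ (DirFree H) => (F c + dirCirc H q (t c)) ^ 2)
      (Measure.pi fun _ : Fin D => boxDirichlet H) := fun c =>
    integrable_comp_eval_piD (((memLp_const (F c)).add (memLp_two_dirCirc q)).integrable_sq) c
  rw [integral_const_mul, integral_finsetSum _ fun c _ => hint c]
  have hc : ∀ c : Fin D, ∫ t : Fin D → EuclideanSpace ℝ (DirFree H), (F c + dirCirc H q (t c)) ^ 2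
      ∂(Measure.pi fun _ : Fin D => boxDirichlet H) = F c ^ 2 + boxDirProjKernel H q q := fun c => by
    rw [integral_pi_eval (boxDirichlet H) (fun s => (F c + dirCirc H q s) ^ 2) c, integral_const_add_dirCirc_sq]
  simp_rw [hc]
  rw [Finset.sum_add_distrib, Finset.sum_const, Finset.card_univ, Fintype.card_fin]
  simp only [nsmul_eq_mul]
  ring

/-- **`D` colours, second moment**: `E_{D^{⊗D}}[(½Σ_c (F_c + X_q(t_c))²)²] ≤ 2D·Σ_c (F_c⁴ + 3V_D(q)²)`. [folklore] -/
theorem integral_quadObs_sq_piD_le (F : Fin D → ℝ) (q : Plaq 4) :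
    ∫ t : Fin D → EuclideanSpace ℝ (DirFree H), ((1 / 2 : ℝ) * ∑ c, (F c + dirCirc H q (t c)) ^ 2) ^ 2
        ∂(Measure.pi fun _ : Fin D => boxDirichlet H) ≤
      2 * (D : ℝ) * ∑ c, (F c ^ 4 + 3 * boxDirProjKernel H q q ^ 2) := by
  set P := Measure.pi fun _ : Fin D => boxDirichlet H with hP
  have hint4 : ∀ c : Fin D, Integrable (fun t : Fin D → EuclideanSpace ℝ (DirFree H) => (F c + dirCirc H q (t c)) ^ 4) P := by
    intro c
    have hFX : MemLp (fun s => F c + dirCirc H q s) 4 (boxDirichlet H) := (memLp_const (F c)).add (memLp_four_dirCirc q)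
    have h1 : Integrable (fun s => (F c + dirCirc H q s) ^ 4) (boxDirichlet H) := by
      refine (hFX.integrable_norm_pow (by norm_num)).congr (ae_of_all _ fun t => ?_)
      simp only [Real.norm_eq_abs]
      exact (show Even 4 by decide).pow_abs _
    exact integrable_comp_eval_piD h1 c
  -- pointwise Cauchy–Schwarz: `(½Σ_c Y_c)² ≤ (D/4) Σ_c Y_c²`, `Y_c = (F_c + X_c)²`, `Y_c² = (F_c+X_c)⁴`
  have hpt : ∀ t : Fin D → EuclideanSpace ℝ (DirFree H),
      ((1 / 2 : ℝ) * ∑ c, (F c + dirCirc H q (t c)) ^ 2) ^ 2 ≤ (D : ℝ) / 4 * ∑ c, (F c + dirCirc H q (t c)) ^ 4 := by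
    intro t
    have h := sq_sum_le_card_mul_sum_sq (D := D) (fun c => (F c + dirCirc H q (t c)) ^ 2)
    have e4 : ∀ c, ((F c + dirCirc H q (t c)) ^ 2) ^ 2 = (F c + dirCirc H q (t c)) ^ 4 := fun c => by ring
    simp only [e4] at h
    calc ((1 / 2 : ℝ) * ∑ c, (F c + dirCirc H q (t c)) ^ 2) ^ 2 = 1 / 4 * (∑ c, (F c + dirCirc H q (t c)) ^ 2) ^ 2 := by ring
      _ ≤ 1 / 4 * ((D : ℝ) * ∑ c, (F c + dirCirc H q (t c)) ^ 4) := by linarith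
      _ = (D : ℝ) / 4 * ∑ c, (F c + dirCirc H q (t c)) ^ 4 := by ring
  have hsq_int : Integrable (fun t : Fin D → EuclideanSpace ℝ (DirFree H) =>
      ((1 / 2 : ℝ) * ∑ c, (F c + dirCirc H q (t c)) ^ 2) ^ 2) P := by
    refine Integrable.mono' ((integrable_finsetSum Finset.univ fun c _ => hint4 c).const_mul ((D : ℝ) / 4)) ?_ (ae_of_all _ fun t => ?_)
    · refine (AEStronglyMeasurable.pow ?_ 2)
      refine AEStronglyMeasurable.const_mul (Finset.aestronglyMeasurable_fun_sum _ fun c _ => ?_) _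
      exact ((integrable_comp_eval_piD (((memLp_const (F c)).add (memLp_two_dirCirc q)).integrable_sq) c)).aestronglyMeasurable
    · rw [Real.norm_eq_abs, abs_of_nonneg (sq_nonneg _)]
      exact hpt t
  have hD0 : (0 : ℝ) ≤ (D : ℝ) / 4 := by positivity
  calc ∫ t, ((1 / 2 : ℝ) * ∑ c, (F c + dirCirc H q (t c)) ^ 2) ^ 2 ∂P
      ≤ ∫ t, (D : ℝ) / 4 * ∑ c, (F c + dirCirc H q (t c)) ^ 4 ∂P :=
        integral_mono hsq_int ((integrable_finsetSum Finset.univ fun c _ => hint4 c).const_mul _) hpt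
    _ = (D : ℝ) / 4 * ∑ c, ∫ t, (F c + dirCirc H q (t c)) ^ 4 ∂P := by
        rw [integral_const_mul, integral_finsetSum _ fun c _ => hint4 c]
    _ = (D : ℝ) / 4 * ∑ c, ∫ s, (F c + dirCirc H q s) ^ 4 ∂(boxDirichlet H) := by
        congr 1
        refine Finset.sum_congr rfl fun c _ => ?_
        exact integral_pi_eval (boxDirichlet H) (fun s => (F c + dirCirc H q s) ^ 4) c
    _ ≤ (D : ℝ) / 4 * ∑ c, 8 * (F c ^ 4 + 3 * boxDirProjKernel H q q ^ 2) := by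
        refine mul_le_mul_of_nonneg_left (Finset.sum_le_sum fun c _ => ?_) hD0
        exact integral_const_add_dirCirc_pow_four_le (F c) q
    _ = 2 * (D : ℝ) * ∑ c, (F c ^ 4 + 3 * boxDirProjKernel H q q ^ 2) := by
        rw [← Finset.mul_sum]; ring

/-- One colour of the quadratic observable is square integrable under the `D`-fold product measure. [folklore] -/
theorem memLp_two_const_add_dirCirc_sq_piD (F : ℝ) (q : Plaq 4) (c : Fin D) :
    MemLp (fun t : Fin D → EuclideanSpace ℝ (DirFree H) => (F + dirCirc H q (t c)) ^ 2) 2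
      (Measure.pi fun _ : Fin D => boxDirichlet H) := by
  have hFX : MemLp (fun s => F + dirCirc H q s) 4 (boxDirichlet H) := (memLp_const F).add (memLp_four_dirCirc q)
  have h1 : Integrable (fun s => (F + dirCirc H q s) ^ 4) (boxDirichlet H) := by
    refine (hFX.integrable_norm_pow (by norm_num)).congr (ae_of_all _ fun t => ?_)
    simp only [Real.norm_eq_abs]
    exact (show Even 4 by decide).pow_abs _
  have h4 : Integrable (fun t : Fin D → EuclideanSpace ℝ (DirFree H) => (F + dirCirc H q (t c)) ^ 4)
      (Measure.pi fun _ : Fin D => boxDirichlet H) := integrable_comp_eval_piD h1 c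
  have h2 : Integrable (fun t : Fin D → EuclideanSpace ℝ (DirFree H) => (F + dirCirc H q (t c)) ^ 2)
      (Measure.pi fun _ : Fin D => boxDirichlet H) :=
    integrable_comp_eval_piD (((memLp_const F).add (memLp_two_dirCirc q)).integrable_sq) c
  rw [memLp_two_iff_integrable_sq h2.aestronglyMeasurable]
  refine h4.congr (ae_of_all _ fun t => ?_)
  simp only
  ring

/-- The `D`-colour quadratic observable is square integrable under the product measure. [folklore] -/
theorem memLp_two_quadObs_piD (F : Fin D → ℝ) (q : Plaq 4) :
    MemLp (fun t : Fin D → EuclideanSpace ℝ (DirFree H) => (1 / 2 : ℝ) * ∑ c, (F c + dirCirc H q (t c)) ^ 2) 2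
      (Measure.pi fun _ : Fin D => boxDirichlet H) :=
  (memLp_finsetSum Finset.univ fun c _ => memLp_two_const_add_dirCirc_sq_piD (F c) q c).const_mul _

/-- **Gaussian evaluation after restriction to a likely event, `D` colours.**  For every measurable `G̃` of the `D`-colour space with
`D^{⊗D}(G̃ᶜ) ≤ η ≤ 1/2`:  `|E_{D^{⊗D}}[½Σ_c (F_c + X_q(t_c))² | G̃] − (D/2)·V_D(q) − ½Σ_c F_c²| ≤ 2(1 + 2D·Σ_c(F_c⁴ + 3V_D(q)²))·√η`. [folklore] -/
theorem abs_integral_cond_quadObs_sub_leD (F : Fin D → ℝ) (q : Plaq 4)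
    {G : Set (Fin D → EuclideanSpace ℝ (DirFree H))} (hG : MeasurableSet G) {η : ℝ}
    (hη : (Measure.pi fun _ : Fin D => boxDirichlet H).real Gᶜ ≤ η) (hη2 : η ≤ 1 / 2) :
    |(∫ t, (1 / 2 : ℝ) * ∑ c, (F c + dirCirc H q (t c)) ^ 2 ∂((Measure.pi fun _ : Fin D => boxDirichlet H)[|G])) -
        ((D : ℝ) / 2 * boxDirProjKernel H q q + 1 / 2 * ∑ c, F c ^ 2)| ≤
      2 * (1 + 2 * (D : ℝ) * ∑ c, (F c ^ 4 + 3 * boxDirProjKernel H q q ^ 2)) * Real.sqrt η := by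
  have h1 := abs_integral_sub_integral_cond_le_of_sq (μ := Measure.pi fun _ : Fin D => boxDirichlet H) hG
    (memLp_two_quadObs_piD F q) hη hη2
  rw [integral_quadObs_piD_eq, abs_sub_comm] at h1
  refine h1.trans ?_
  have hη0 : 0 ≤ η := le_trans measureReal_nonneg hη
  have h2 := integral_quadObs_sq_piD_le (H := H) F q
  have h3 : 0 ≤ Real.sqrt η := Real.sqrt_nonneg η
  nlinarith

/-- **The Gaussian side of the kernel mean expansion, datum form, `D` colours.**  For one-colour Dirichlet data `ϑ : Fin D → (edges → ℝ)`
with means `μ_c = mean ϑ_c` and background circulations `F̄_c(q) = sCirc (glue ϑ_c μ_c) q`, and every measurable `G̃` with `D^{⊗D}(G̃ᶜ) ≤ η ≤ 1/2`: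
`|E_{D^{⊗D}}[½Σ_c (sCirc (glue ϑ_c (μ_c + t_c)) q)² | G̃] − (D/2)·boxDirProjKernel H q q − ½Σ_c F̄_c(q)²| ≤ 2(1 + 2DΣ_c(F̄_c(q)⁴ + 3V_D(q)²))·√η`.
[folklore] -/
theorem abs_integral_cond_quadObs_datum_sub_leD (ϑ : Fin D → (Literature.MathematicalPhysics.QuantumLattice.ZdEdge 4 → ℝ)) (q : Plaq 4)
    {G : Set (Fin D → EuclideanSpace ℝ (DirFree H))} (hG : MeasurableSet G) {η : ℝ}
    (hη : (Measure.pi fun _ : Fin D => boxDirichlet H).real Gᶜ ≤ η) (hη2 : η ≤ 1 / 2) :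
    |(∫ t, (1 / 2 : ℝ) * ∑ c, (sCirc (glue (pin := fun e => e ∉ dirFreeEdges H) dirCorner (2 * H + 3) (ϑ c)
          (mean (fun e => e ∉ dirFreeEdges H) dirCorner (2 * H + 3) (ϑ c) + WithLp.ofLp (t c))) q) ^ 2
          ∂((Measure.pi fun _ : Fin D => boxDirichlet H)[|G])) -
        ((D : ℝ) / 2 * boxDirProjKernel H q q + 1 / 2 * ∑ c, (sCirc (glue (pin := fun e => e ∉ dirFreeEdges H) dirCorner (2 * H + 3)
          (ϑ c) (mean (fun e => e ∉ dirFreeEdges H) dirCorner (2 * H + 3) (ϑ c))) q) ^ 2)| ≤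
      2 * (1 + 2 * (D : ℝ) * ∑ c, ((sCirc (glue (pin := fun e => e ∉ dirFreeEdges H) dirCorner (2 * H + 3) (ϑ c)
          (mean (fun e => e ∉ dirFreeEdges H) dirCorner (2 * H + 3) (ϑ c))) q) ^ 4 + 3 * boxDirProjKernel H q q ^ 2)) *
        Real.sqrt η := by
  simp_rw [sCirc_glue_add_ofLp]
  exact abs_integral_cond_quadObs_sub_leD _ q hG hη hη2

/-- **Unrestricted form** (η-free), `D` colours: `E_{D^{⊗D}}[½Σ_c (sCirc (glue ϑ_c (μ_c + t_c)) q)²] = (D/2)·boxDirProjKernel H q q + ½Σ_c F̄_c(q)²`.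
[folklore] -/
theorem integral_quadObs_datum_eqD (ϑ : Fin D → (Literature.MathematicalPhysics.QuantumLattice.ZdEdge 4 → ℝ)) (q : Plaq 4) :
    ∫ t : Fin D → EuclideanSpace ℝ (DirFree H), (1 / 2 : ℝ) * ∑ c,
        (sCirc (glue (pin := fun e => e ∉ dirFreeEdges H) dirCorner (2 * H + 3) (ϑ c)
          (mean (fun e => e ∉ dirFreeEdges H) dirCorner (2 * H + 3) (ϑ c) + WithLp.ofLp (t c))) q) ^ 2
        ∂(Measure.pi fun _ : Fin D => boxDirichlet H) =
      (D : ℝ) / 2 * boxDirProjKernel H q q + 1 / 2 * ∑ c, (sCirc (glue (pin := fun e => e ∉ dirFreeEdges H) dirCorner (2 * H + 3)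
          (ϑ c) (mean (fun e => e ∉ dirFreeEdges H) dirCorner (2 * H + 3) (ϑ c))) q) ^ 2 := by
  simp_rw [sCirc_glue_add_ofLp]
  exact integral_quadObs_piD_eq _ q

end Summit.QuantumFields.YangMills.Theorems.ColdBoxAllGroups

end
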